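import Literature.MathematicalPhysics.QuantumFieldTheory.Balaban1983to89.T3TailTransferLower
import HarnessLib

/-!
# `Balaban1983to89.T3CentreSymmetrySUN` — rung R3 «then SU(N)»: the `Z_N` CENTRE SYMMETRY of the unit-scale averaged Polyakov loop
# (`⟨W̄_P⟩_K = 0`, `⟨W̄_P²⟩_K = ⟨‖tr P̄‖²⟩_K/(2N²)` for `N ≥ 3`), the `K = 0` margin `⟨W̄_P²⟩₀ ≥ 1/(2N²)`, and NT3 for `SU(N)`

CITATION HEADER (lean-in-tree rule).  Cell `ym3-torus` (HUMAN RULING D-0037, YM ladder rung R3: `SU(2)`, «then `SU(N)`»), seat `ym3-torus-p2` gen 6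
(HOME/IR-NODE.md §3b, §12).  Sources: G. 't Hooft, Nucl. Phys. B **153** (1979) 141 [tHooft1979Flux] §2 (the electric `Z_N` centre symmetry: twisting
the links through a hyperplane by a centre element preserves the Wilson action); L. McLerran, B. Svetitsky, Phys. Lett. B **98** (1981) 195
[McLerranSvetitsky1981] (the Polyakov line picks up the centre element, so its expectation vanishes when the symmetry is realised — exactly, in
every finite periodic volume); T. Bałaban, CMP **109** (1987) [Balaban1987RG1] (0.4), (2.17) (block averaging commutes with the symmetries; tree
`CentreTwistBlockAvg.exists_iter_blockAvg_ctwist`); C. Borgs, E. Seiler, CMP **91** (1983) [BorgsSeiler1983] §III.1 (III.23) p. 347 (`⟨|Tr u|²⟩ ≥ 1`;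
tree `PolyakovDiagonalBound`); S. Chatterjee in Friz et al. (eds.) 2019 [Chatterjee2019YMProbabilists] §6 p. 19.

WHAT IS PROVED.  The tree's `T3CentreSymmetry` treats a trace-FLIPPING central INVOLUTION (`SU(2)`, `z = −1`).  For `SU(N)` the centre is `Z_N`
and the real loop variable `Re tr/N` is not an eigenfunction of the twist, so the law-level statement is phrased for arbitrary functions of the
averaged holonomy: §1 (any compact `G`, any central `z`) **`expect_comp_avgHol_twist`** — the `K`-th Wilson expectation of `φ(𝒰̄_K(C))` equals that
of `φ(z^{wind_μ C} · 𝒰̄_K(C))` for EVERY `φ : G → ℝ` (fine twist ↦ top twist by (2.17), winding law, exact symmetry of the Wilson weight), iterated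
in `expect_comp_avgHol_twist_pow`.  §2 `G = SU(N)`: the centre element `ω·1`, `ω = e^{2πi/N}` (`exists_centre_SU`), and the root-of-unity sums.
§3 for the Polyakov label (`wind = 1`), every `K`, every measurable `ℰ`, `γ ≥ 0`: **`expectAt_polyakov_eq_zero_SU`** (`⟨W̄_P⟩_K = 0`, `N ≥ 2`) and
**`expectAt_polyakov_pair_eq_SU`** (`⟨W̄_P W̄_P⟩_K = ⟨‖tr 𝒰̄_K(P)‖²⟩_K /(2N²)`, `N ≥ 3`: average `(Re ω^k t)²` over `Z_N`).  §4 the margin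
**`expectAt_zero_polyakov_pair_ge_SU`** (`⟨W̄_P W̄_P⟩₀ ≥ 1/(2N²)`, `N ≥ 3`, base point in the plane `t = 0`; Borgs–Seiler at `K = 0`) and
**`uniformVariance_polyakov_of_smallMass_SU`** — `UnitTiltTail F ℰ γ r w w'` (summable, non-negative) + `c + Σ(w + w') ≤ e^{−2Σr}/(2N²)` ⇒
`UniformVariance (F.scheme ℰ γ) (polyakov 0 x) c` (`T3TailTransferLower.le_integral_unitLaw_mul`), `limitPointsNontrivial_of_smallMass_SU`.
WHAT THIS IS NOT: not NT3 or K1/K2; the `SU(2)` case (margin `1/4`) is `T3PolyakovVariance`/`T3TailTransferLower`.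
-/

noncomputable section

open MeasureTheory Filter Topology
open scoped ComplexConjugate
open Literature.MathematicalPhysics.QuantumFieldTheory.Balaban1983to89.T4Continuum
open Literature.MathematicalPhysics.QuantumFieldTheory.Balaban1983to89.T3ContinuumYM3Torus
open Literature.MathematicalPhysics.QuantumFieldTheory.Balaban1983to89.T3ThresholdRemoval
open Literature.MathematicalPhysics.QuantumFieldTheory.Balaban1983to89.T3UnitScaleTilt
open Literature.MathematicalPhysics.QuantumFieldTheory.Balaban1983to89.T3PolyakovVariance
open Literature.MathematicalPhysics.QuantumFieldTheory.Balaban1983to89.T3TailTransferLower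
open Literature.MathematicalPhysics.QuantumFieldTheory.Balaban1983to89.PolyakovDiagonalBound

namespace Literature.MathematicalPhysics.QuantumFieldTheory.Balaban1983to89.T3CentreSymmetrySUN

/-! ## 1. Twist invariance of the law of an averaged loop holonomy (any `G`, any central `z`) -/

section General

variable (F : T3Family) {G : Type*} [GaugeGroup G] [MeasurableSpace G] [HaarData G] [MeasurableMul G] (ℰ : LoopAverage G) {z : G}

omit [MeasurableSpace G] [HaarData G] [MeasurableMul G] in
/-- **THE WINDING LAW AT THE TOP LATTICE**: twisting the `K`-fold averaged field along a slice multiplies the holonomy of the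
representative walk of a label `C` by `z^{wind_μ C}` (tree `holAt_ctwist_walk_of_netDisp_eq_mul`). [cite: McLerranSvetitsky1981] -/
theorem holAt_ctwist_atLevel (hz : ∀ g : G, z * g = g * z) (μ : Fin 3) (K : ℕ) (s : ZMod ((F.P K).sitesPerDir K)) (C : ULoop3 F)
    (V : GaugeField (F.P K) K G) : holAt (V.ctwist z μ s) (C.1.atLevel K) = z ^ C.wind μ * holAt V (C.1.atLevel K) := by
  rw [UWord3.atLevel, holAt_ctwist_walk_of_netDisp_eq_mul hz μ s V _ (C.netDisp_eq_wind_mul μ K)]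

/-- **THE LAW OF THE AVERAGED HOLONOMY IS TWIST-COVARIANT**: for a central `z`, a direction `μ`, every label `C`, every `K`, every real `β`
and EVERY `φ : G → ℝ`, `⟨φ(𝒰̄_K(C))⟩ = ⟨φ(z^{wind_μ C} · 𝒰̄_K(C))⟩` — some twist of the finest torus maps under the `K`-fold (0.4)-averaging to
the top twist ([Balaban1987RG1] (2.17); tree `exists_iter_blockAvg_ctwist`), the top twist multiplies the holonomy of the representative walk by
`z^{wind}` (`holAt_ctwist_walk_of_netDisp_eq_mul`), and the fine twist preserves the Wilson expectation (`Missing.expect_ctwist`). [cite: tHooft1979Flux, §2] -/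
theorem expect_comp_avgHol_twist (hz : ∀ g : G, z * g = g * z) (μ : Fin 3) (β : ℝ) (K : ℕ) (C : ULoop3 F) (φ : G → ℝ) :
    Missing.expect (F.P K) β (fun U => φ (holAt (Averaging.iter
        (fun j => BlockAveraging.blockAvg (P := F.P K) (j := j) ℰ) K U) (C.1.atLevel K))) =
      Missing.expect (F.P K) β (fun U => φ (z ^ C.wind μ * holAt (Averaging.iter
        (fun j => BlockAveraging.blockAvg (P := F.P K) (j := j) ℰ) K U) (C.1.atLevel K))) := by
  obtain ⟨s₀, h₀⟩ := BlockAveraging.exists_iter_blockAvg_ctwist (P := F.P K) ℰ hz μ K (Nat.le_add_left K F.m) 0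
  have hsym := Missing.expect_ctwist hz (F.P K) β μ s₀ (fun U => φ (holAt (Averaging.iter
    (fun j => BlockAveraging.blockAvg (P := F.P K) (j := j) ℰ) K U) (C.1.atLevel K)))
  rw [← hsym]
  congr 1
  funext U
  rw [h₀ U, holAt_ctwist_atLevel F hz μ K 0 C (Averaging.iter (fun j => BlockAveraging.blockAvg (P := F.P K) (j := j) ℰ) K U)]

/-- Iterated: `⟨φ(𝒰̄_K(C))⟩ = ⟨φ(z^{k·wind_μ C} · 𝒰̄_K(C))⟩` for every `k : ℕ`. [cite: tHooft1979Flux, §2] -/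
theorem expect_comp_avgHol_twist_pow (hz : ∀ g : G, z * g = g * z) (μ : Fin 3) (β : ℝ) (K : ℕ) (C : ULoop3 F) (φ : G → ℝ) :
    ∀ k : ℕ, Missing.expect (F.P K) β (fun U => φ (holAt (Averaging.iter
        (fun j => BlockAveraging.blockAvg (P := F.P K) (j := j) ℰ) K U) (C.1.atLevel K))) =
      Missing.expect (F.P K) β (fun U => φ (z ^ ((k : ℤ) * C.wind μ) * holAt (Averaging.iter
        (fun j => BlockAveraging.blockAvg (P := F.P K) (j := j) ℰ) K U) (C.1.atLevel K)))
  | 0 => by simp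
  | k + 1 => by
    rw [expect_comp_avgHol_twist_pow hz μ β K C φ k,
      expect_comp_avgHol_twist F ℰ hz μ β K C (fun g => φ (z ^ ((k : ℤ) * C.wind μ) * g))]
    congr 1
    funext U
    rw [← mul_assoc, ← zpow_add]
    congr 3
    push_cast
    ring

end General

/-! ## 2. `SU(N)`: the centre element `ω·1` and root-of-unity sums -/

section Centre

open Literature.MathematicalPhysics.QuantumLattice

variable (N : ℕ) [NeZero N]

/-- **THE CENTRE ELEMENT `ω·1 ∈ SU(N)`, `ω = e^{2πi/N}`**: central, with `(ω·1)^k g` of trace `ω^k tr g`; `Σ_{k<N} ω^k = 0` for `N ≥ 2` and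
`Σ_{k<N} ω^{2k} = 0` for `N ≥ 3`, `‖ω‖ = 1`. [cite: tHooft1979Flux, §2] -/
theorem exists_centre_SU : ∃ (z : Matrix.specialUnitaryGroup (Fin N) ℂ) (ω : ℂ), (∀ g, z * g = g * z) ∧ ‖ω‖ = 1 ∧
    (∀ (k : ℕ) (g : Matrix.specialUnitaryGroup (Fin N) ℂ),
      ((z ^ k * g : Matrix.specialUnitaryGroup (Fin N) ℂ) : Matrix (Fin N) (Fin N) ℂ).trace =
        ω ^ k * (g : Matrix (Fin N) (Fin N) ℂ).trace) ∧
    (2 ≤ N → ∑ k ∈ Finset.range N, ω ^ k = 0) ∧ (3 ≤ N → ∑ k ∈ Finset.range N, (ω ^ 2) ^ k = 0) := by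
  set ω : ℂ := Complex.exp (2 * Real.pi * Complex.I / N) with hω_def
  have hω : IsPrimitiveRoot ω N := Complex.isPrimitiveRoot_exp N (NeZero.ne N)
  have hωN : ω ^ N = 1 := hω.pow_eq_one
  have hω1 : ‖ω‖ = 1 := Complex.norm_eq_one_of_pow_eq_one hωN (NeZero.ne N)
  have hωc : ω * conj ω = 1 := by
    rw [Complex.mul_conj, Complex.normSq_eq_norm_sq, hω1]
    norm_num
  -- the matrix `ω·1`
  have hmem : ω • (1 : Matrix (Fin N) (Fin N) ℂ) ∈ Matrix.specialUnitaryGroup (Fin N) ℂ := by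
    rw [Matrix.mem_specialUnitaryGroup_iff]
    refine ⟨?_, ?_⟩
    · rw [Matrix.mem_unitaryGroup_iff, star_smul, star_one, Matrix.smul_mul, Matrix.mul_smul, one_mul, smul_smul,
        Complex.star_def, hωc, one_smul]
    · rw [Matrix.det_smul, Matrix.det_one, mul_one, Fintype.card_fin, hωN]
  refine ⟨⟨ω • (1 : Matrix (Fin N) (Fin N) ℂ), hmem⟩, ω, fun g => Subtype.ext ?_, hω1, fun k g => ?_, fun hN => ?_, fun hN => ?_⟩
  · show ω • (1 : Matrix (Fin N) (Fin N) ℂ) * (g : Matrix (Fin N) (Fin N) ℂ) = (g : Matrix (Fin N) (Fin N) ℂ) * (ω • 1)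
    rw [Matrix.smul_mul, Matrix.mul_smul, one_mul, mul_one]
  · have h1 : ((⟨ω • (1 : Matrix (Fin N) (Fin N) ℂ), hmem⟩ ^ k * g : Matrix.specialUnitaryGroup (Fin N) ℂ) :
        Matrix (Fin N) (Fin N) ℂ) = (ω • (1 : Matrix (Fin N) (Fin N) ℂ)) ^ k * (g : Matrix (Fin N) (Fin N) ℂ) := by
      rw [Submonoid.coe_mul, SubmonoidClass.coe_pow]
    rw [h1, smul_pow, one_pow, Matrix.smul_mul, one_mul, Matrix.trace_smul, smul_eq_mul]
  · exact hω.geom_sum_eq_zero hN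
  · have hne : ω ^ 2 ≠ 1 := by
      intro h2
      have hdvd : N ∣ 2 := (hω.pow_eq_one_iff_dvd 2).mp h2
      have := Nat.le_of_dvd two_pos hdvd
      omega
    rw [geom_sum_eq hne, ← pow_mul, mul_comm, pow_mul, hωN, one_pow, sub_self, zero_div]

variable {N}

omit [NeZero N] in
/-- `Re`-squares averaged over `Z_N` (`N ≥ 3`): `Σ_{k<N} (Re(ω^k t))² = N‖t‖²/2` when `‖ω‖ = 1` and `Σ_{k<N} ω^{2k} = 0`. [folklore] -/
private theorem sum_re_sq_eq {ω : ℂ} (hω1 : ‖ω‖ = 1) (h2 : ∑ k ∈ Finset.range N, (ω ^ 2) ^ k = 0) (t : ℂ) :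
    ∑ k ∈ Finset.range N, (ω ^ k * t).re ^ 2 = N * ‖t‖ ^ 2 / 2 := by
  have hre : ∀ u : ℂ, u.re ^ 2 = (‖u‖ ^ 2 + (u ^ 2).re) / 2 := fun u => by
    rw [Complex.sq_norm, Complex.normSq_apply, sq u, Complex.mul_re]
    ring
  have h3 : ∑ k ∈ Finset.range N, ‖ω ^ k * t‖ ^ 2 = N * ‖t‖ ^ 2 := by
    simp_rw [norm_mul, norm_pow, hω1, one_pow, one_mul]
    rw [Finset.sum_const, Finset.card_range, nsmul_eq_mul]
  have h4 : ∑ k ∈ Finset.range N, ((ω ^ k * t) ^ 2).re = 0 := by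
    rw [← Complex.re_sum]
    have : ∑ k ∈ Finset.range N, (ω ^ k * t) ^ 2 = (∑ k ∈ Finset.range N, (ω ^ 2) ^ k) * t ^ 2 := by
      rw [Finset.sum_mul]
      refine Finset.sum_congr rfl fun k _ => ?_
      rw [mul_pow, ← pow_mul, ← pow_mul, mul_comm 2 k]
    rw [this, h2, zero_mul, Complex.zero_re]
  rw [Finset.sum_congr rfl fun k _ => hre (ω ^ k * t), ← Finset.sum_div, Finset.sum_add_distrib, h3, h4, add_zero]

end Centre

/-! ## 3. `SU(N)`: the averaged Polyakov loop has zero mean (`N ≥ 2`) and `⟨W̄_P²⟩ = ⟨‖tr‖²⟩/(2N²)` (`N ≥ 3`) at every cutoff -/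

section Polyakov

open Literature.MathematicalPhysics.QuantumLattice

variable {N : ℕ} [NeZero N] (F : T3Family) (ℰ : LoopAverage (Matrix.specialUnitaryGroup (Fin N) ℂ)) {γ : ℝ}

/-- The normalised trace of the series on `SU(N)` is `Re tr/N`. [cite: Balaban1987RG1, (0.2)/(0.4) p.252] -/
private theorem reTr_SU (g : Matrix.specialUnitaryGroup (Fin N) ℂ) :
    reTr g = ((g : Matrix (Fin N) (Fin N) ℂ).trace).re / N := by
  show UnitaryModel.nReTr (fundamentalRep (Fin N) g) = _
  rw [UnitaryModel.nReTr, fundamentalRep_apply, Fintype.card_fin]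

/-- Measurability of the averaged holonomy of a label (measurable `ℰ`). [cite: Balaban1987RG1, (0.2)/(0.4) p.252] -/
private theorem measurable_avgHol (hE : ℰ.MeasurableE) (K : ℕ) (C : ULoop3 F) :
    Measurable fun U : GaugeField (F.P K) 0 (Matrix.specialUnitaryGroup (Fin N) ℂ) =>
      holAt (Averaging.iter (fun j => BlockAveraging.blockAvg (P := F.P K) (j := j) ℰ) K U) (C.1.atLevel K) :=
  (measurable_holAt _).comp (measurable_iter _ (F.avgMeasurable_of_measurableE ℰ hE K) K)

/-- **`Z_N` CENTRE SYMMETRY KILLS THE MEAN OF THE AVERAGED POLYAKOV LOOP at every cutoff** (`SU(N)`, `N ≥ 2`, measurable `ℰ`, `γ ≥ 0`):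
`⟨W̄_P⟩_K = 0` — the average over `k ∈ Z_N` of `Re(ω^k tr 𝒰̄)/N` vanishes pointwise (`Σ ω^k = 0`). [cite: McLerranSvetitsky1981] -/
theorem expectAt_polyakov_eq_zero_SU (hN : 2 ≤ N) (hE : ℰ.MeasurableE) (hγ : 0 ≤ γ) (μ : Fin 3) (x : F.USite) (K : ℕ) :
    (F.scheme ℰ γ).expectAt K [ULoop3.polyakov μ x] = 0 := by
  obtain ⟨z, ω, hz, hω1, htr, hsum1, -⟩ := exists_centre_SU N
  set β := (F.scheme ℰ γ).β K with hβ_def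
  have hβ : 0 ≤ β := F.scheme_β_nonneg ℰ hγ K
  set hol : GaugeField (F.P K) 0 (Matrix.specialUnitaryGroup (Fin N) ℂ) → Matrix.specialUnitaryGroup (Fin N) ℂ :=
    fun U => holAt (Averaging.iter (fun j => BlockAveraging.blockAvg (P := F.P K) (j := j) ℰ) K U)
      ((ULoop3.polyakov μ x).1.atLevel K) with hhol
  have hhol_m : Measurable hol := measurable_avgHol F ℰ hE K _
  -- the expectation in question, as an expectation of `reTr ∘ hol`
  have h0 : (F.scheme ℰ γ).expectAt K [ULoop3.polyakov μ x] = Missing.expect (F.P K) β fun U => reTr (hol U) := by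
    show Missing.expect (F.P K) β (fun U => ([ULoop3.polyakov μ x].map fun C => F.avgObs ℰ K C U).prod) = _
    congr 1
    funext U
    simp only [List.map_cons, List.map_nil, List.prod_cons, List.prod_nil, mul_one]
    rfl
  -- each twisted copy has the same expectation
  have hk : ∀ k : ℕ, Missing.expect (F.P K) β (fun U => reTr (hol U)) =
      Missing.expect (F.P K) β (fun U => reTr (z ^ k * hol U)) := fun k => by
    have h := expect_comp_avgHol_twist_pow F ℰ hz μ β K (ULoop3.polyakov μ x) reTr k
    rw [ULoop3.wind_polyakov, mul_one, zpow_natCast] at h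
    exact h
  -- pass to the Gibbs measure and average over `Z_N`
  haveI := T4GenFunBounds.isProbabilityMeasure_gibbsMeasure (G := Matrix.specialUnitaryGroup (Fin N) ℂ) (F.P K) hβ
  have hint : ∀ k : ℕ, Integrable (fun U => reTr (z ^ k * hol U))
      (T4GenFunBounds.gibbsMeasure (G := Matrix.specialUnitaryGroup (Fin N) ℂ) (F.P K) β) := fun k =>
    (integrable_const (1 : ℝ)).mono'
      (RegularGaugeGroup.measurable_reTr.comp ((measurable_const_mul _).comp hhol_m)).aestronglyMeasurable
      (ae_of_all _ fun U => by rw [Real.norm_eq_abs]; exact RegularGaugeGroup.abs_reTr_le_one _)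
  have hsumE : (N : ℝ) * Missing.expect (F.P K) β (fun U => reTr (hol U)) =
      ∑ k ∈ Finset.range N, Missing.expect (F.P K) β (fun U => reTr (z ^ k * hol U)) := by
    rw [Finset.sum_congr rfl fun k _ => (hk k).symm, Finset.sum_const, Finset.card_range, nsmul_eq_mul]
  have hptw : ∀ U, ∑ k ∈ Finset.range N, reTr (z ^ k * hol U) = 0 := fun U => by
    simp_rw [reTr_SU, htr, ← Finset.sum_div, ← Complex.re_sum, ← Finset.sum_mul, hsum1 hN, zero_mul, Complex.zero_re, zero_div]
  have hzero : ∑ k ∈ Finset.range N, Missing.expect (F.P K) β (fun U => reTr (z ^ k * hol U)) = 0 := by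
    simp_rw [← T4GenFunBounds.integral_gibbsMeasure_eq_expect (F.P K) hβ]
    rw [← integral_finsetSum _ fun k _ => hint k]
    simp_rw [hptw, integral_zero]
  have hNpos : (0 : ℝ) < N := by exact_mod_cast (lt_of_lt_of_le two_pos hN)
  rw [h0]
  have := hsumE.trans hzero
  rcases mul_eq_zero.mp this with h | h
  · exact absurd h hNpos.ne'
  · exact h

/-- **`⟨W̄_P W̄_P⟩_K = ⟨‖tr 𝒰̄_K(P)‖²⟩_K /(2N²)` at every cutoff** (`SU(N)`, `N ≥ 3`, measurable `ℰ`, `γ ≥ 0`): the average over `Z_N` of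
`(Re ω^k t)²` is `‖t‖²/2`. [cite: McLerranSvetitsky1981] -/
theorem expectAt_polyakov_pair_eq_SU (hN : 3 ≤ N) (hE : ℰ.MeasurableE) (hγ : 0 ≤ γ) (μ : Fin 3) (x : F.USite) (K : ℕ) :
    (F.scheme ℰ γ).expectAt K [ULoop3.polyakov μ x, ULoop3.polyakov μ x] =
      Missing.expect (F.P K) ((F.scheme ℰ γ).β K) (fun U => ‖((holAt (Averaging.iter
        (fun j => BlockAveraging.blockAvg (P := F.P K) (j := j) ℰ) K U) ((ULoop3.polyakov μ x).1.atLevel K) :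
          Matrix.specialUnitaryGroup (Fin N) ℂ) : Matrix (Fin N) (Fin N) ℂ).trace‖ ^ 2) / (2 * (N : ℝ) ^ 2) := by
  obtain ⟨z, ω, hz, hω1, htr, -, hsum2⟩ := exists_centre_SU N
  set β := (F.scheme ℰ γ).β K with hβ_def
  have hβ : 0 ≤ β := F.scheme_β_nonneg ℰ hγ K
  set hol : GaugeField (F.P K) 0 (Matrix.specialUnitaryGroup (Fin N) ℂ) → Matrix.specialUnitaryGroup (Fin N) ℂ :=
    fun U => holAt (Averaging.iter (fun j => BlockAveraging.blockAvg (P := F.P K) (j := j) ℰ) K U)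
      ((ULoop3.polyakov μ x).1.atLevel K) with hhol
  have hhol_m : Measurable hol := measurable_avgHol F ℰ hE K _
  have h0 : (F.scheme ℰ γ).expectAt K [ULoop3.polyakov μ x, ULoop3.polyakov μ x] =
      Missing.expect (F.P K) β fun U => reTr (hol U) ^ 2 := by
    show Missing.expect (F.P K) β (fun U => ([ULoop3.polyakov μ x, ULoop3.polyakov μ x].map
      fun C => F.avgObs ℰ K C U).prod) = _
    congr 1
    funext U
    simp only [List.map_cons, List.map_nil, List.prod_cons, List.prod_nil, mul_one, sq]
    rfl
  have hk : ∀ k : ℕ, Missing.expect (F.P K) β (fun U => reTr (hol U) ^ 2) =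
      Missing.expect (F.P K) β (fun U => reTr (z ^ k * hol U) ^ 2) := fun k => by
    have h := expect_comp_avgHol_twist_pow F ℰ hz μ β K (ULoop3.polyakov μ x) (fun g => reTr g ^ 2) k
    rw [ULoop3.wind_polyakov, mul_one, zpow_natCast] at h
    exact h
  haveI := T4GenFunBounds.isProbabilityMeasure_gibbsMeasure (G := Matrix.specialUnitaryGroup (Fin N) ℂ) (F.P K) hβ
  have hmeas_k : ∀ k : ℕ, Measurable fun U => reTr (z ^ k * hol U) := fun k =>
    RegularGaugeGroup.measurable_reTr.comp ((measurable_const_mul _).comp hhol_m)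
  have hint : ∀ k : ℕ, Integrable (fun U => reTr (z ^ k * hol U) ^ 2)
      (T4GenFunBounds.gibbsMeasure (G := Matrix.specialUnitaryGroup (Fin N) ℂ) (F.P K) β) := fun k =>
    (integrable_const (1 : ℝ)).mono' ((hmeas_k k).pow_const 2).aestronglyMeasurable
      (ae_of_all _ fun U => by
        rw [Real.norm_eq_abs, abs_pow, pow_le_one_iff_of_nonneg (abs_nonneg _) two_ne_zero]
        exact RegularGaugeGroup.abs_reTr_le_one _)
  have htr_m : Measurable fun U => ‖((hol U : Matrix.specialUnitaryGroup (Fin N) ℂ) : Matrix (Fin N) (Fin N) ℂ).trace‖ ^ 2 :=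
    ((continuous_norm.comp ((Continuous.matrix_trace continuous_subtype_val))).measurable.comp hhol_m).pow_const 2
  have htr_b : ∀ U, ‖((hol U : Matrix.specialUnitaryGroup (Fin N) ℂ) : Matrix (Fin N) (Fin N) ℂ).trace‖ ^ 2 ≤ (N : ℝ) ^ 2 := by
    intro U
    have hu := fundamentalRep_mem_unitaryGroup (hol U)
    rw [fundamentalRep_apply] at hu
    have h1 : ‖((hol U : Matrix.specialUnitaryGroup (Fin N) ℂ) : Matrix (Fin N) (Fin N) ℂ).trace‖ ≤ N := by
      rw [Matrix.trace]
      refine (norm_sum_le _ _).trans ?_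
      calc ∑ i, ‖Matrix.diag ((hol U : Matrix.specialUnitaryGroup (Fin N) ℂ) : Matrix (Fin N) (Fin N) ℂ) i‖
          ≤ ∑ _i : Fin N, (1 : ℝ) := Finset.sum_le_sum fun i _ => entry_norm_bound_of_unitary hu i i
        _ = N := by simp
    exact pow_le_pow_left₀ (norm_nonneg _) h1 2
  have hint2 : Integrable (fun U => ‖((hol U : Matrix.specialUnitaryGroup (Fin N) ℂ) : Matrix (Fin N) (Fin N) ℂ).trace‖ ^ 2)
      (T4GenFunBounds.gibbsMeasure (G := Matrix.specialUnitaryGroup (Fin N) ℂ) (F.P K) β) :=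
    (integrable_const ((N : ℝ) ^ 2)).mono' htr_m.aestronglyMeasurable
      (ae_of_all _ fun U => by rw [Real.norm_eq_abs, abs_of_nonneg (by positivity)]; exact htr_b U)
  have hsumE : (N : ℝ) * Missing.expect (F.P K) β (fun U => reTr (hol U) ^ 2) =
      ∑ k ∈ Finset.range N, Missing.expect (F.P K) β (fun U => reTr (z ^ k * hol U) ^ 2) := by
    rw [Finset.sum_congr rfl fun k _ => (hk k).symm, Finset.sum_const, Finset.card_range, nsmul_eq_mul]
  have hptw : ∀ U, ∑ k ∈ Finset.range N, reTr (z ^ k * hol U) ^ 2 =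
      ‖((hol U : Matrix.specialUnitaryGroup (Fin N) ℂ) : Matrix (Fin N) (Fin N) ℂ).trace‖ ^ 2 / (2 * N) := by
    intro U
    simp_rw [reTr_SU, htr, div_pow, ← Finset.sum_div, sum_re_sq_eq hω1 (hsum2 hN)]
    have hN0 : (N : ℝ) ≠ 0 := Nat.cast_ne_zero.mpr (NeZero.ne N)
    rw [div_div, div_eq_div_iff (by positivity) (by positivity)]
    ring
  have hval : ∑ k ∈ Finset.range N, Missing.expect (F.P K) β (fun U => reTr (z ^ k * hol U) ^ 2) =
      Missing.expect (F.P K) β (fun U =>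
        ‖((hol U : Matrix.specialUnitaryGroup (Fin N) ℂ) : Matrix (Fin N) (Fin N) ℂ).trace‖ ^ 2) / (2 * N) := by
    simp_rw [← T4GenFunBounds.integral_gibbsMeasure_eq_expect (F.P K) hβ]
    rw [← integral_finsetSum _ fun k _ => hint k]
    simp_rw [hptw]
    rw [integral_div]
  have hN0 : (N : ℝ) ≠ 0 := Nat.cast_ne_zero.mpr (NeZero.ne N)
  rw [h0]
  have := hsumE.trans hval
  field_simp at this ⊢
  linarith [this]

end Polyakov

/-! ## 4. The `K = 0` margin `⟨W̄_P W̄_P⟩₀ ≥ 1/(2N²)` and NT3 for `SU(N)`, `N ≥ 3` -/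

section NT

open Literature.MathematicalPhysics.QuantumLattice

variable {N : ℕ} [NeZero N] (F : T3Family) (ℰ : LoopAverage (Matrix.specialUnitaryGroup (Fin N) ℂ)) {γ : ℝ}
  {r w w' : ℕ → ℝ}

/-- **THE MARGIN AT `K₀ = 0` FOR `SU(N)`, `N ≥ 3`**: `1/(2N²) ≤ ⟨W̄_P · W̄_P⟩₀` for the Polyakov label through a base point in the
hyperplane `t = 0` (measurable `ℰ`, none applied at `K = 0`; `γ ≥ 0`) — Borgs–Seiler's `⟨‖tr P‖²⟩ ≥ 1` and the `Z_N` identity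
`⟨W̄_P²⟩ = ⟨‖tr‖²⟩/(2N²)`. [cite: BorgsSeiler1983, §III.1 (III.23) p.347] -/
theorem expectAt_zero_polyakov_pair_ge_SU (hN : 3 ≤ N) (hE : ℰ.MeasurableE) (hγ : 0 ≤ γ) {x : F.USite} (hx : x 0 = 0) :
    1 / (2 * (N : ℝ) ^ 2) ≤ (F.scheme ℰ γ).expectAt 0 [ULoop3.polyakov 0 x, ULoop3.polyakov 0 x] := by
  rw [expectAt_polyakov_pair_eq_SU F ℰ hN hE hγ 0 x 0]
  have h := one_le_expect_normSq_trace_polyakov (N := N) (F.P 0) (F.scheme_β_nonneg ℰ hγ 0) hx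
  have heq : (fun U : GaugeField (F.P 0) 0 (Matrix.specialUnitaryGroup (Fin N) ℂ) =>
      ‖((holAt (Averaging.iter (fun j => BlockAveraging.blockAvg (P := F.P 0) (j := j) ℰ) 0 U)
        ((ULoop3.polyakov 0 x).1.atLevel 0) : Matrix.specialUnitaryGroup (Fin N) ℂ) : Matrix (Fin N) (Fin N) ℂ).trace‖ ^ 2) =
      fun U => ‖((holAt U (walk x (List.replicate ((F.P 0).sitesPerDir 0) (0, true))) :
        Matrix.specialUnitaryGroup (Fin N) ℂ) : Matrix (Fin N) (Fin N) ℂ).trace‖ ^ 2 := by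
    funext U
    rw [atLevel_zero_polyakov]
    rfl
  rw [heq]
  have hN2 : (0 : ℝ) < 2 * (N : ℝ) ^ 2 := by positivity
  exact div_le_div_of_nonneg_right h hN2.le

/-- The unit-field observable `W̄_P · W̄_P` of the Polyakov label lies in `[0, 1]` and is measurable (any `G`). [cite: Balaban1987RG1, (0.2)/(0.4) p.252] -/
private theorem pairObs_props_SU (x : F.USite) :
    Measurable (fun u : GaugeField (F.P 0) 0 (Matrix.specialUnitaryGroup (Fin N) ℂ) =>
        ([ULoop3.polyakov 0 x, ULoop3.polyakov 0 x].map fun C => loopAt u (C.1.atLevel 0)).prod) ∧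
      (∀ u : GaugeField (F.P 0) 0 (Matrix.specialUnitaryGroup (Fin N) ℂ),
        0 ≤ ([ULoop3.polyakov 0 x, ULoop3.polyakov 0 x].map fun C => loopAt u (C.1.atLevel 0)).prod) ∧
      ∀ u : GaugeField (F.P 0) 0 (Matrix.specialUnitaryGroup (Fin N) ℂ),
        ([ULoop3.polyakov 0 x, ULoop3.polyakov 0 x].map fun C => loopAt u (C.1.atLevel 0)).prod ≤ 1 := by
  simp only [List.map_cons, List.map_nil, List.prod_cons, List.prod_nil, mul_one]
  refine ⟨(measurable_loopAt _).mul (measurable_loopAt _), fun u => mul_self_nonneg _, fun u => ?_⟩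
  have h1 := abs_loopAt_le_one u ((ULoop3.polyakov (F := F) 0 x).1.atLevel 0)
  nlinarith [abs_nonneg (loopAt u ((ULoop3.polyakov (F := F) 0 x).1.atLevel 0)),
    abs_mul_abs_self (loopAt u ((ULoop3.polyakov (F := F) 0 x).1.atLevel 0))]

variable {F ℰ}

/-- **NT3 FOR `SU(N)`, `N ≥ 3`, smallness on the large-field masses only**: `UnitTiltTail F ℰ γ r w w'` (summable non-negative rates,
measurable `ℰ`, `γ ≥ 0`) and `c + Σ(w + w') ≤ e^{−2Σr}/(2N²)`, `0 < c` ⇒ `UniformVariance (F.scheme ℰ γ) (polyakov 0 x) c` for every base point in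
the plane `t = 0` (multiplicative transfer `le_integral_unitLaw_mul` of the margin; the mean vanishes at every `K` by `Z_N`). [cite: Chatterjee2019YMProbabilists, §6 p.19] -/
theorem uniformVariance_polyakov_of_smallMass_SU (hN : 3 ≤ N) (hE : ℰ.MeasurableE) (hγ : 0 ≤ γ) (h : UnitTiltTail F ℰ γ r w w')
    (hr : Summable r) (hw : Summable w) (hw' : Summable w') (hr0 : ∀ K, 0 ≤ r K) (hw0 : ∀ K, 0 ≤ w K) (hw0' : ∀ K, 0 ≤ w' K)
    {x : F.USite} (hx : x 0 = 0) {c : ℝ} (hc : 0 < c)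
    (hsmall : c + ∑' i, (w i + w' i) ≤ Real.exp (-2 * ∑' i, r i) / (2 * (N : ℝ) ^ 2)) :
    UniformVariance (F.scheme ℰ γ) (ULoop3.polyakov 0 x) c := by
  obtain ⟨hWm, hW0, hW1⟩ := pairObs_props_SU F (N := N) x
  refine ⟨hc, Eventually.of_forall fun K => ?_⟩
  rw [expectAt_polyakov_eq_zero_SU F ℰ (by omega) hE hγ 0 x K]
  simp only [ne_eq, OfNat.ofNat_ne_zero, not_false_eq_true, zero_pow, sub_zero]
  have h0 := expectAt_zero_polyakov_pair_ge_SU F ℰ hN hE hγ hx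
  rw [expectAt_eq_integral_unitLaw hE hγ 0] at h0
  have h1 := le_integral_unitLaw_mul hE hγ h hr hw hw' hr0 hw0 hw0' hWm hW0 hW1 0 K (Nat.zero_le K)
  simp only [zero_add] at h1
  have h2 := mul_le_mul_of_nonneg_left h0 (Real.exp_pos (-2 * ∑' i, r i)).le
  rw [div_eq_mul_one_div (Real.exp _)] at hsmall
  rw [expectAt_eq_integral_unitLaw hE hγ K]
  linarith

/-- Hence `LimitPointsNontrivial (F.scheme ℰ γ)` for `SU(N)`, `N ≥ 3`, whenever `Σ(w + w') < e^{−2Σr}/(2N²)`. [cite: JaffeWittenClay2006, §4 p.6] -/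
theorem limitPointsNontrivial_of_smallMass_SU (hN : 3 ≤ N) (hE : ℰ.MeasurableE) (hγ : 0 ≤ γ) (h : UnitTiltTail F ℰ γ r w w')
    (hr : Summable r) (hw : Summable w) (hw' : Summable w') (hr0 : ∀ K, 0 ≤ r K) (hw0 : ∀ K, 0 ≤ w K) (hw0' : ∀ K, 0 ≤ w' K)
    (hsmall : ∑' i, (w i + w' i) < Real.exp (-2 * ∑' i, r i) / (2 * (N : ℝ) ^ 2)) : LimitPointsNontrivial (F.scheme ℰ γ) := by
  have hx : (0 : F.USite) 0 = 0 := rfl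
  exact limitPointsNontrivial_of_uniformVariance
    (uniformVariance_polyakov_of_smallMass_SU hN hE hγ h hr hw hw' hr0 hw0 hw0' hx
      (c := (Real.exp (-2 * ∑' i, r i) / (2 * (N : ℝ) ^ 2) - ∑' i, (w i + w' i)) / 2) (by linarith) (by linarith))

/-- **THE RUNG'S TARGET PLUS NON-TRIVIALITY FOR `SU(N)`, `N ≥ 3`** under `UnitTiltTail` with summable non-negative rates and
`Σ(w + w') < e^{−2Σr}/(2N²)`. [cite: JaffeWittenClay2006, §6.5 p.11] -/
theorem continuumYM3Torus_nontrivial_of_smallMass_SU (hN : 3 ≤ N) (hE : ℰ.MeasurableE) (hγ : 0 ≤ γ)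
    (h : UnitTiltTail F ℰ γ r w w') (hr : Summable r) (hw : Summable w) (hw' : Summable w') (hr0 : ∀ K, 0 ≤ r K)
    (hw0 : ∀ K, 0 ≤ w K) (hw0' : ∀ K, 0 ≤ w' K)
    (hsmall : ∑' i, (w i + w' i) < Real.exp (-2 * ∑' i, r i) / (2 * (N : ℝ) ^ 2)) :
    ContinuumYM3Torus F ℰ γ ∧ LimitPointsNontrivial (F.scheme ℰ γ) :=
  ⟨continuumYM3Torus_of_unitTiltTail F ℰ hE hγ hr hw hw' h,
    limitPointsNontrivial_of_smallMass_SU hN hE hγ h hr hw hw' hr0 hw0 hw0' hsmall⟩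

end NT

end Literature.MathematicalPhysics.QuantumFieldTheory.Balaban1983to89.T3CentreSymmetrySUN

end
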